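import Mathlib
import HarnessLib
import Summits.ResolutionOfSingularities.ResolutionOfSingularities.Theorems.WildQuotientsWildQuotientResolutionS1aRingKillDataOfCert

/-!
# S1a — CC-S FOR THE (2,1) KILL LEAF: its weighted filtration is CANONICAL (`𝒥₂ = {y ∈ I_C : σy − y ∈ β I_C²}`), so two leaf frames AGREE

[OURS · L1 W4.5c · lead-1 g10; SUCCESSOR-BRIEF v1.3 §3 (2) «the K-content is UNIFORMITY along C of one weighting (CC-S)» / KILL-CRITERION v1 §4 — the
agreement clause of `KillAgreeReach` (p623915) for the census' only kill type, at ring level, inside one node] — NOT statements of the manuscript;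
counted 0; AI-level work, weaker than expert review. Crux stmt-ResolutionOfSingularities-17941 `CyclicQuotientFourfolds`, line `s1a-logminvertex` v10,
K-side (`stub_killTouchReachAux`). Route-independent; pure commutative algebra.

For a frame `f = (x₁, x₃)` with weights `(2, 1)` write `I = (x₁, x₃)` and `𝒥ₙ` for its weighted filtration.
* `prod_eq_pow_mul_pow`, `weight_eq`, `pow_mul_pow_mem`, ★ `weightedFiltration_one` (`𝒥₁ = I`), ★ `weightedFiltration_two` (`𝒥₂ = (x₁) ⊔ I²`),
  ★ `weightedFiltration_add_two` (`𝒥ₙ₊₂ = 𝒥₁𝒥ₙ₊₁ ⊔ 𝒥₂𝒥ₙ`: the filtration is determined by `𝒥₁` and `𝒥₂`), `weightedFiltration_three_le_sq`;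
* `mem_span_of_mul_mem_sq` — quasi-regularity: `x₁` regular and `x₃` regular mod `x₁` ⇒ (`c x₁ ∈ I² ⇒ c ∈ I`); `isSMulRegular_of_isRegular₂` (from
  Mathlib's `RingTheory.Sequence.IsRegular`);
* ★★★ `mem_weightedFiltration_two_iff_of_leaf` — THE HEAVY DIRECTION IS INTRINSIC: for a leaf frame (`β`, `x₁` regular elements, `x₃` regular mod `x₁`,
  `σ c − c ∈ β I` for all `c`, `σ x₁ − x₁ ∈ β 𝒥₃`, `σ x₃ − x₃ − β h x₁ ∈ β 𝒥₃` with `h` a unit): `y ∈ 𝒥₂ ↔ y ∈ I ∧ σ y − y ∈ β I²` — i.e. `𝒥₂/I²` is the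
  kernel (= image) of the nilpotent `θ̄ = (σ − 1)/β` on the conormal module `I/I²`, independent of the frame;
* ★★★ `weightedFiltration_eq_of_leaf` — **AGREEMENT (CC-S for the leaf)**: two leaf frames `f, f'` for the same `(σ, β)` with the same centre ideal
  `(f) = (f')` have THE SAME weighted filtration, `𝒥ₙ(f) = 𝒥ₙ(f')` for all `n` (different units `h, h'`, different heavy coordinates allowed). Hence
  kill charts of leaf type along one component of the bad locus, read in one node ring, agree on overlaps — the (K1) clause of `KillAgreeReach`.
-/

set_option linter.dupNamespace false

noncomputable section

open Literature.AlgebraicGeometry.Resolution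
open scoped Pointwise

namespace Summit.ResolutionOfSingularities.ResolutionOfSingularities.Theorems.WildQuotientResolution.S1.KillCert

universe u

variable {B : Type u} [CommRing B]

/-! ## Monomial combinatorics for the weights `(2, 1)` -/

section Weights

variable (f : Fin 2 → B)

/-- The monomial `f^α = x₁^{α₀} x₃^{α₁}`. -/
theorem prod_eq_pow_mul_pow (α : Fin 2 →₀ ℕ) : (α.prod fun i e => f i ^ e) = f 0 ^ α 0 * f 1 ^ α 1 := by
  rw [Finsupp.prod_fintype _ _ (fun _ => pow_zero _), Fin.prod_univ_two]

/-- Its weight `2 α₀ + α₁`. -/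
theorem weight_eq (α : Fin 2 →₀ ℕ) : Finsupp.weight (![2, 1] : Fin 2 → ℕ) α = 2 * α 0 + α 1 := by
  rw [Finsupp.weight_apply, Finsupp.sum_fintype _ _ (fun _ => by simp), Fin.sum_univ_two]
  simp only [smul_eq_mul, Matrix.cons_val_zero, Matrix.cons_val_one, Matrix.cons_val_fin_one]
  ring

omit [CommRing B] in
/-- `Set.range f = {x₁, x₃}`. -/
theorem range_eq_pair : Set.range f = {f 0, f 1} := by
  ext x
  simp only [Set.mem_range, Set.mem_insert_iff, Set.mem_singleton_iff]
  constructor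
  · rintro ⟨i, rfl⟩
    fin_cases i
    · exact Or.inl rfl
    · exact Or.inr rfl
  · rintro (rfl | rfl)
    · exact ⟨0, rfl⟩
    · exact ⟨1, rfl⟩

/-- `x₁^a x₃^b ∈ 𝒥_{2a+b}`. -/
theorem pow_mul_pow_mem (a b : ℕ) : f 0 ^ a * f 1 ^ b ∈ (weightedFiltration f ![2, 1]).ideal (2 * a + b) := by
  classical
  refine Ideal.subset_span ⟨Finsupp.single 0 a + Finsupp.single 1 b, ?_, ?_⟩
  · rw [weight_eq]
    simp
  · rw [prod_eq_pow_mul_pow]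
    simp

/-- ★ `𝒥₁ = I = (x₁, x₃)`. [OURS · L1 W4.5c] -/
theorem weightedFiltration_one : (weightedFiltration f ![2, 1]).ideal 1 = Ideal.span (Set.range f) := by
  apply le_antisymm
  · rw [weightedFiltration_ideal, Ideal.span_le]
    rintro _ ⟨α, hα, rfl⟩
    rw [weight_eq] at hα
    rw [SetLike.mem_coe, prod_eq_pow_mul_pow]
    by_cases ha : α 0 = 0
    · have hb : α 1 ≠ 0 := by omega
      obtain ⟨b', hb'⟩ := Nat.exists_eq_succ_of_ne_zero hb
      rw [hb', pow_succ, ← mul_assoc]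
      exact Ideal.mul_mem_left _ _ (Ideal.subset_span ⟨1, rfl⟩)
    · obtain ⟨a', ha'⟩ := Nat.exists_eq_succ_of_ne_zero ha
      have e : f 0 ^ α 0 * f 1 ^ α 1 = (f 0 ^ a' * f 1 ^ α 1) * f 0 := by rw [ha', pow_succ]; ring
      rw [e]
      exact Ideal.mul_mem_left _ _ (Ideal.subset_span ⟨0, rfl⟩)
  · rw [Ideal.span_le]
    rintro _ ⟨i, rfl⟩
    fin_cases i
    · exact (weightedFiltration f ![2, 1]).antitone (by norm_num : 1 ≤ 2) (mem_weightedFiltration_ideal f ![2, 1] 0)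
    · exact mem_weightedFiltration_ideal f ![2, 1] 1

/-- ★ `𝒥₂ = (x₁) ⊔ I²`. [OURS · L1 W4.5c] -/
theorem weightedFiltration_two : (weightedFiltration f ![2, 1]).ideal 2 = Ideal.span {f 0} ⊔ Ideal.span (Set.range f) ^ 2 := by
  apply le_antisymm
  · rw [weightedFiltration_ideal, Ideal.span_le]
    rintro _ ⟨α, hα, rfl⟩
    rw [weight_eq] at hα
    rw [SetLike.mem_coe, prod_eq_pow_mul_pow]
    by_cases ha : α 0 = 0
    · have hb : 2 ≤ α 1 := by omega
      obtain ⟨b', hb'⟩ := Nat.exists_eq_add_of_le hb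
      rw [ha, pow_zero, one_mul, hb', pow_add]
      have hf1 : f 1 ∈ Ideal.span (Set.range f) := Ideal.subset_span ⟨1, rfl⟩
      exact Ideal.mem_sup_right (Ideal.mul_mem_right _ _ (Ideal.pow_mem_pow hf1 2))
    · obtain ⟨a', ha'⟩ := Nat.exists_eq_succ_of_ne_zero ha
      have e : f 0 ^ α 0 * f 1 ^ α 1 = (f 0 ^ a' * f 1 ^ α 1) * f 0 := by rw [ha', pow_succ]; ring
      rw [e]
      exact Ideal.mem_sup_left (Ideal.mul_mem_left _ _ (Ideal.mem_span_singleton_self _))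
  · refine sup_le ?_ ?_
    · rw [Ideal.span_singleton_le_iff_mem]
      exact mem_weightedFiltration_ideal f ![2, 1] 0
    · rw [← weightedFiltration_one, pow_two]
      exact (weightedFiltration f ![2, 1]).mul_le 1 1

/-- ★ **The (2,1)-filtration is determined by `𝒥₁` and `𝒥₂`**: `𝒥ₙ₊₂ = 𝒥₁ 𝒥ₙ₊₁ ⊔ 𝒥₂ 𝒥ₙ` (a monomial of weight `≥ n+2` is `x₃ ·`(weight `≥ n+1`) or
`x₁ ·`(weight `≥ n`)). [OURS · L1 W4.5c] -/
theorem weightedFiltration_add_two (n : ℕ) :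
    (weightedFiltration f ![2, 1]).ideal (n + 2) =
      (weightedFiltration f ![2, 1]).ideal 1 * (weightedFiltration f ![2, 1]).ideal (n + 1) ⊔
        (weightedFiltration f ![2, 1]).ideal 2 * (weightedFiltration f ![2, 1]).ideal n := by
  apply le_antisymm
  · conv_lhs => rw [weightedFiltration_ideal]
    rw [Ideal.span_le]
    rintro _ ⟨α, hα, rfl⟩
    rw [weight_eq] at hα
    rw [SetLike.mem_coe, prod_eq_pow_mul_pow]
    by_cases hb : α 1 = 0
    · have ha : 1 ≤ α 0 := by omega
      obtain ⟨a', ha'⟩ := Nat.exists_eq_add_of_le ha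
      rw [hb, pow_zero, mul_one, ha', pow_add, pow_one]
      refine Ideal.mem_sup_right (Ideal.mul_mem_mul (mem_weightedFiltration_ideal f ![2, 1] 0) ?_)
      have h := pow_mul_pow_mem f a' 0
      rw [pow_zero, mul_one] at h
      exact (weightedFiltration f ![2, 1]).antitone (by omega) h
    · obtain ⟨b', hb'⟩ := Nat.exists_eq_succ_of_ne_zero hb
      have e : f 0 ^ α 0 * f 1 ^ α 1 = f 1 * (f 0 ^ α 0 * f 1 ^ b') := by rw [hb', pow_succ]; ring
      rw [e]
      refine Ideal.mem_sup_left (Ideal.mul_mem_mul (mem_weightedFiltration_ideal f ![2, 1] 1) ?_)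
      exact (weightedFiltration f ![2, 1]).antitone (by omega) (pow_mul_pow_mem f (α 0) b')
  · refine sup_le ?_ ?_
    · have h := (weightedFiltration f ![2, 1]).mul_le 1 (n + 1)
      rwa [show 1 + (n + 1) = n + 2 by ring] at h
    · have h := (weightedFiltration f ![2, 1]).mul_le 2 n
      rwa [show 2 + n = n + 2 by ring] at h

/-- `𝒥₃ ≤ I²`. -/
theorem weightedFiltration_three_le_sq : (weightedFiltration f ![2, 1]).ideal 3 ≤ Ideal.span (Set.range f) ^ 2 := by
  rw [weightedFiltration_add_two f 1, ← weightedFiltration_one f, pow_two]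
  refine sup_le (Ideal.mul_mono_right ((weightedFiltration f ![2, 1]).antitone (by norm_num : 1 ≤ 2)))
    (Ideal.mul_mono_left ((weightedFiltration f ![2, 1]).antitone (by norm_num : 1 ≤ 2)))

end Weights

/-! ## Quasi-regularity of the frame -/

/-- **Quasi-regularity.** If `x₁` is a regular element and `x₃` is regular modulo `x₁`, then `c · x₁ ∈ I²` forces `c ∈ I = (x₁, x₃)`
(the conormal module `I/I²` is free on `x̄₁, x̄₃`). [folklore] -/
theorem mem_span_of_mul_mem_sq (f : Fin 2 → B) (hf0 : IsSMulRegular B (f 0))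
    (hf1 : ∀ t : B, f 1 * t ∈ Ideal.span {f 0} → t ∈ Ideal.span {f 0}) {c : B}
    (hc : c * f 0 ∈ Ideal.span (Set.range f) ^ 2) : c ∈ Ideal.span (Set.range f) := by
  rw [range_eq_pair] at hc ⊢
  -- `I² ≤ x₁ · I ⊔ (x₃²)`
  have hle : Ideal.span ({f 0, f 1} : Set B) ^ 2 ≤ Ideal.span {f 0} * Ideal.span ({f 0, f 1} : Set B) ⊔ Ideal.span {f 1 ^ 2} := by
    rw [pow_two, Ideal.mul_le]
    intro a ha b hb
    obtain ⟨u, v, rfl⟩ := Ideal.mem_span_pair.mp ha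
    obtain ⟨u', v', rfl⟩ := Ideal.mem_span_pair.mp hb
    have e : (u * f 0 + v * f 1) * (u' * f 0 + v' * f 1) =
        f 0 * (u * u' * f 0 + (u * v' + v * u') * f 1) + (v * v') * f 1 ^ 2 := by ring
    rw [e]
    refine Ideal.add_mem _ (Ideal.mem_sup_left (Ideal.mul_mem_mul (Ideal.mem_span_singleton_self _)
      (Ideal.mem_span_pair.mpr ⟨_, _, rfl⟩))) (Ideal.mem_sup_right (Ideal.mul_mem_left _ _ (Ideal.mem_span_singleton_self _)))
  obtain ⟨y, hy, z, hz, hyz⟩ := Submodule.mem_sup.mp (hle hc)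
  obtain ⟨i, hi, rfl⟩ := Ideal.mem_span_singleton_mul.mp hy
  obtain ⟨t, rfl⟩ := Ideal.mem_span_singleton'.mp hz
  -- `t x₃² = (c − i) x₁ ⇒ t ∈ (x₁)`
  have ht : t ∈ Ideal.span {f 0} := by
    apply hf1
    apply hf1
    refine Ideal.mem_span_singleton'.mpr ⟨c - i, ?_⟩
    linear_combination -hyz
  obtain ⟨t', rfl⟩ := Ideal.mem_span_singleton'.mp ht
  -- cancel `x₁`
  have hc' : c = i + t' * f 1 * f 1 := by
    have e : f 0 • c = f 0 • (i + t' * f 1 * f 1) := by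
      simp only [smul_eq_mul]
      linear_combination -hyz
    exact hf0 e
  rw [hc']
  exact Ideal.add_mem _ hi (Ideal.mul_mem_left _ _ (Ideal.subset_span (Or.inr rfl)))

/-- From Mathlib's regular sequences: `(x₁, x₃)` regular ⇒ `x₁` is a regular element and `x₃` is regular modulo `x₁`. [folklore] -/
theorem isSMulRegular_of_isRegular₂ (f : Fin 2 → B) (h : RingTheory.Sequence.IsRegular B (List.ofFn f)) :
    IsSMulRegular B (f 0) ∧ ∀ t : B, f 1 * t ∈ Ideal.span {f 0} → t ∈ Ideal.span {f 0} := by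
  have hl : List.ofFn f = [f 0, f 1] := by simp [List.ofFn_succ]
  rw [hl, RingTheory.Sequence.isRegular_cons_iff] at h
  obtain ⟨h0, h1⟩ := h
  rw [RingTheory.Sequence.isRegular_cons_iff] at h1
  refine ⟨h0, fun t ht => ?_⟩
  have hreg := h1.1
  -- in `B ⧸ x₁ • ⊤`, `x₃ • t̄ = 0`, hence `t̄ = 0`
  have hmem : ∀ x : B, x ∈ Ideal.span {f 0} → x ∈ f 0 • (⊤ : Submodule B B) := by
    intro x hx
    obtain ⟨a, rfl⟩ := Ideal.mem_span_singleton'.mp hx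
    exact (Submodule.mem_smul_pointwise_iff_exists _ _ _).mpr ⟨a, Submodule.mem_top, by rw [smul_eq_mul, mul_comm]⟩
  have h0t : (Submodule.Quotient.mk (f 1 * t) : QuotSMulTop (f 0) B) = 0 :=
    (Submodule.Quotient.mk_eq_zero _).mpr (hmem _ ht)
  have ht0 : (Submodule.Quotient.mk t : QuotSMulTop (f 0) B) = 0 := by
    apply hreg.right_eq_zero_of_smul
    rw [← Submodule.Quotient.mk_smul, smul_eq_mul]
    exact h0t
  obtain ⟨a, -, ha⟩ := (Submodule.mem_smul_pointwise_iff_exists _ _ _).mp ((Submodule.Quotient.mk_eq_zero _).mp ht0)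
  rw [← ha, smul_eq_mul, mul_comm]
  exact Ideal.mul_mem_left _ _ (Ideal.mem_span_singleton_self _)

/-! ## The heavy direction is intrinsic; agreement -/

section Leaf

variable (σ : B ≃+* B) (β : B)

/-- ★★★ **THE HEAVY DIRECTION OF THE (2,1) LEAF IS INTRINSIC.** Leaf frame: `β` and `x₁` regular elements, `x₃` regular modulo `x₁`, `σ c − c ∈ β I` for
every `c ∈ B` (boundary-admissibility in degree 0), `σ x₁ − x₁ ∈ β 𝒥₃`, `σ x₃ − x₃ − β h x₁ ∈ β 𝒥₃` with `h` a unit. Then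
`y ∈ 𝒥₂ ↔ (y ∈ I ∧ σ y − y ∈ β · I²)`: the degree-2 piece `𝒥₂ = (x₁) + I²` is the set of elements of `I` whose increment vanishes to second order along `C`
modulo the boundary — the kernel of the nilpotent endomorphism `θ̄ = (σ − 1)/β` of the conormal module `I/I²` — and does not depend on the frame.
(→ uses (a′); ← : write `y = a x₁ + b x₃`, then `σy − y ≡ β b h x₁ (mod β I²)`, cancel `β`, quasi-regularity gives `b ∈ I`.)
[OURS · L1 W4.5c · CC-S for the leaf; NOT a statement of the manuscript] -/
theorem mem_weightedFiltration_two_iff_of_leaf (f : Fin 2 → B) (h : B) (hβ : IsSMulRegular B β) (hh : IsUnit h)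
    (hf0 : IsSMulRegular B (f 0)) (hf1 : ∀ t : B, f 1 * t ∈ Ideal.span {f 0} → t ∈ Ideal.span {f 0})
    (hadm0 : ∀ c : B, σ c - c ∈ Ideal.span {β} * Ideal.span (Set.range f))
    (c₁ : σ (f 0) - f 0 ∈ Ideal.span {β} * (weightedFiltration f ![2, 1]).ideal 3)
    (c₃ : σ (f 1) - f 1 - β * h * f 0 ∈ Ideal.span {β} * (weightedFiltration f ![2, 1]).ideal 3) (y : B) :
    y ∈ (weightedFiltration f ![2, 1]).ideal 2 ↔
      y ∈ Ideal.span (Set.range f) ∧ σ y - y ∈ Ideal.span {β} * Ideal.span (Set.range f) ^ 2 := by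
  have hJ3 : Ideal.span {β} * (weightedFiltration f ![2, 1]).ideal 3 ≤ Ideal.span {β} * Ideal.span (Set.range f) ^ 2 :=
    Ideal.mul_mono_right (weightedFiltration_three_le_sq f)
  constructor
  · intro hy
    refine ⟨?_, ?_⟩
    · rw [← weightedFiltration_one f]
      exact (weightedFiltration f ![2, 1]).antitone (by norm_num : 1 ≤ 2) hy
    · -- (a′) at degree 2
      have c₃' : σ (f 1) - f 1 ∈ Ideal.span {β} * (weightedFiltration f ![2, 1]).ideal 2 := by
        have hx : β * h * f 0 ∈ Ideal.span {β} * (weightedFiltration f ![2, 1]).ideal 2 := by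
          rw [mul_assoc]
          exact Ideal.mul_mem_mul (Ideal.mem_span_singleton_self β) (Ideal.mul_mem_left _ h (mem_weightedFiltration_ideal f ![2, 1] 0))
        have := Ideal.add_mem _ (Ideal.mul_mono_right ((weightedFiltration f ![2, 1]).antitone (by norm_num : 2 ≤ 3)) c₃) hx
        rwa [sub_add_cancel] at this
      have hfw : ∀ i : Fin 2, σ (f i) - f i ∈ Ideal.span {β} * (weightedFiltration f ![2, 1]).ideal ((![2, 1] : Fin 2 → ℕ) i + 1) := by
        intro i
        fin_cases i
        exacts [c₁, c₃']
      have hadm := admissible_of_generators f ![2, 1] σ β Set.univ Subring.closure_univ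
        (fun g _ => by rw [weightedFiltration_one]; exact hadm0 g) hfw 2 y hy
      exact hJ3 hadm
  · rintro ⟨hyI, hσy⟩
    have hyI' := hyI
    rw [range_eq_pair] at hyI'
    obtain ⟨a, b, hab⟩ := Ideal.mem_span_pair.mp hyI'
    have hf0I : f 0 ∈ Ideal.span (Set.range f) := Ideal.subset_span ⟨0, rfl⟩
    have hf1I : f 1 ∈ Ideal.span (Set.range f) := Ideal.subset_span ⟨1, rfl⟩
    have hII : ∀ {u v : B}, u ∈ Ideal.span {β} * Ideal.span (Set.range f) → v ∈ Ideal.span (Set.range f) →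
        u * v ∈ Ideal.span {β} * Ideal.span (Set.range f) ^ 2 := by
      intro u v hu hv
      have := Ideal.mul_mem_mul hu hv
      rwa [mul_assoc, ← pow_two] at this
    -- `σ y − y − β (b h x₁) ∈ β I²`
    have e : σ y - y - β * (b * h * f 0) =
        σ a * (σ (f 0) - f 0) + (σ a - a) * f 0 + σ b * (σ (f 1) - f 1 - β * h * f 0) + (σ b - b) * (f 1 + β * h * f 0) := by
      rw [← hab, map_add, map_mul, map_mul]
      ring
    have hkey : σ y - y - β * (b * h * f 0) ∈ Ideal.span {β} * Ideal.span (Set.range f) ^ 2 := by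
      rw [e]
      refine Ideal.add_mem _ (Ideal.add_mem _ (Ideal.add_mem _ ?_ ?_) ?_) ?_
      · exact Ideal.mul_mem_left _ _ (hJ3 c₁)
      · exact hII (hadm0 a) hf0I
      · exact Ideal.mul_mem_left _ _ (hJ3 c₃)
      · exact hII (hadm0 b) (Ideal.add_mem _ hf1I (Ideal.mul_mem_left _ _ hf0I))
    have hβb : β * (b * h * f 0) ∈ Ideal.span {β} * Ideal.span (Set.range f) ^ 2 := by
      have := Ideal.sub_mem _ hσy hkey
      rwa [sub_sub_cancel] at this
    -- cancel `β`, quasi-regularity, the unit `h`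
    obtain ⟨z, hz, hβz⟩ := Ideal.mem_span_singleton_mul.mp hβb
    have hz' : z = b * h * f 0 := hβ (by simp only [smul_eq_mul]; exact hβz)
    rw [hz'] at hz
    have hbh : b * h ∈ Ideal.span (Set.range f) := mem_span_of_mul_mem_sq f hf0 hf1 hz
    have hb : b ∈ Ideal.span (Set.range f) := (Ideal.mul_unit_mem_iff_mem _ hh).mp hbh
    -- conclude
    rw [weightedFiltration_two, ← hab]
    refine Ideal.add_mem _ (Ideal.mem_sup_left (Ideal.mul_mem_left _ _ (Ideal.mem_span_singleton_self _)))
      (Ideal.mem_sup_right ?_)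
    rw [pow_two]
    exact Ideal.mul_mem_mul hb hf1I

/-- ★★★ **AGREEMENT (CC-S for the (2,1) leaf).** Two leaf frames `f = (x₁, x₃)`, `f' = (x₁', x₃')` for the same automorphism `σ` and boundary `β` with
the same centre ideal `(x₁, x₃) = (x₁', x₃')` have THE SAME weighted filtration: `𝒥ₙ(f) = 𝒥ₙ(f')` for every `n` (`𝒥₁ = I`, `𝒥₂` intrinsic by
`mem_weightedFiltration_two_iff_of_leaf`, and `𝒥ₙ₊₂ = 𝒥₁𝒥ₙ₊₁ + 𝒥₂𝒥ₙ`). The heavy coordinates `x₁, x₁'` and the units `h, h'` may differ. So the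
kill filtrations of leaf-type charts along one component of the bad locus agree wherever both frames live in one ring — the agreement clause of
`KillAgreeReach` for the census' kill type. [OURS · L1 W4.5c · CC-S; NOT a statement of the manuscript] -/
theorem weightedFiltration_eq_of_leaf (f f' : Fin 2 → B) (h h' : B) (hβ : IsSMulRegular B β) (hh : IsUnit h) (hh' : IsUnit h')
    (hf0 : IsSMulRegular B (f 0)) (hf1 : ∀ t : B, f 1 * t ∈ Ideal.span {f 0} → t ∈ Ideal.span {f 0})
    (hf0' : IsSMulRegular B (f' 0)) (hf1' : ∀ t : B, f' 1 * t ∈ Ideal.span {f' 0} → t ∈ Ideal.span {f' 0})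
    (hI : Ideal.span (Set.range f') = Ideal.span (Set.range f))
    (hadm0 : ∀ c : B, σ c - c ∈ Ideal.span {β} * Ideal.span (Set.range f))
    (c₁ : σ (f 0) - f 0 ∈ Ideal.span {β} * (weightedFiltration f ![2, 1]).ideal 3)
    (c₃ : σ (f 1) - f 1 - β * h * f 0 ∈ Ideal.span {β} * (weightedFiltration f ![2, 1]).ideal 3)
    (c₁' : σ (f' 0) - f' 0 ∈ Ideal.span {β} * (weightedFiltration f' ![2, 1]).ideal 3)
    (c₃' : σ (f' 1) - f' 1 - β * h' * f' 0 ∈ Ideal.span {β} * (weightedFiltration f' ![2, 1]).ideal 3) (n : ℕ) :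
    (weightedFiltration f ![2, 1]).ideal n = (weightedFiltration f' ![2, 1]).ideal n := by
  have P0 : (weightedFiltration f ![2, 1]).ideal 0 = (weightedFiltration f' ![2, 1]).ideal 0 := by
    rw [(weightedFiltration f ![2, 1]).ideal_zero, (weightedFiltration f' ![2, 1]).ideal_zero]
  have P1 : (weightedFiltration f ![2, 1]).ideal 1 = (weightedFiltration f' ![2, 1]).ideal 1 := by
    rw [weightedFiltration_one, weightedFiltration_one, hI]
  have P2 : (weightedFiltration f ![2, 1]).ideal 2 = (weightedFiltration f' ![2, 1]).ideal 2 := by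
    ext y
    rw [mem_weightedFiltration_two_iff_of_leaf σ β f h hβ hh hf0 hf1 hadm0 c₁ c₃ y,
      mem_weightedFiltration_two_iff_of_leaf σ β f' h' hβ hh' hf0' hf1' (fun c => by rw [hI]; exact hadm0 c) c₁' c₃' y, hI]
  have key : ∀ m : ℕ, (weightedFiltration f ![2, 1]).ideal m = (weightedFiltration f' ![2, 1]).ideal m ∧
      (weightedFiltration f ![2, 1]).ideal (m + 1) = (weightedFiltration f' ![2, 1]).ideal (m + 1) := by
    intro m
    induction m with
    | zero => exact ⟨P0, P1⟩
    | succ m ih =>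
      refine ⟨ih.2, ?_⟩
      rw [show m + 1 + 1 = m + 2 by ring, weightedFiltration_add_two f m, weightedFiltration_add_two f' m, P1, P2, ih.1, ih.2]
  exact (key n).1

end Leaf

end Summit.ResolutionOfSingularities.ResolutionOfSingularities.Theorems.WildQuotientResolution.S1.KillCert

end
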